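import Summits.ResolutionOfSingularities.ResolutionOfSingularities.Theorems.FrobeniusLadderFInjectiveMacaulayficationFiModelOfIsBlowup
import Summits.ResolutionOfSingularities.ResolutionOfSingularities.Theorems.FrobeniusLadderFInjectiveMacaulayficationAffineBlowupStalkClause
import Summits.ResolutionOfSingularities.ResolutionOfSingularities.Theorems.FrobeniusLadderFInjectiveMacaulayficationClauseOffCentre
import HarnessLib

/-!
# Crux `FInjectiveMacaulayfication`: the ENGINE INTERFACE — a certified-charts blow-up of an integral base is an
F-injective Macaulayfication (line `Sketch`, cycle 6)

Support file for crux `stmt-ResolutionOfSingularities-15315` (`FrobeniusLadder.FInjectiveMacaulayfication`, route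
`ResolutionOfSingularities/FrobeniusLadder`, rung 2), line `Sketch`, registered stub `stub_fiModelOfCharts` (lead assembly,
wave 3 of cycle 6).

One theorem packaging E7 (`FiModelOfIsBlowup.fiModel_of_isBlowup_of_isIntegral`, the global glue), E6″
(`AffineBlowupStalkClause.stub_affineBlowupStalkClause`, the affine blow-up glue in stalk form) and
`ClauseOffCentre.stub_clauseOffCentre` (the off-centre hypothesis from scheme-level data) into the exact interface an
engine for the open core `stub_fInjectivizeIntegral` has to meet. Let `X₁` be integral and locally Noetherian, `J ≠ ⊥` an
ideal sheaf and `π : X' → X₁` a blow-up along `J` (universal property). Suppose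

* (a) OFF THE CENTRE the local rings of `X₁` already satisfy the crux's stalk clause for the exponent base `p` (domain;
  every system of parameters weakly regular; parameter ideals Frobenius closed) — i.e. `supp J` contains the bad locus;
* (b) ON AN AFFINE COVER `S`: every `U ∈ S` has `char Γ(X₁, U) = p`, `J(U) ≠ 0`, and finitely many generators
  `x₁, …, x_r` of `J(U)` such that, for each non-zero `xᵢ`, the chart ring `Γ(U)[J(U)/xᵢ] = (Γ(U)[J(U)t])_{(xᵢt)}`
  satisfies the Cohen–Macaulay + Frobenius-closed clause at every MAXIMAL ideal containing `xᵢ/1` (its closed points on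
  the exceptional divisor — certified in practice by Fedder's criterion E2, deformation E1 or degree-zero descent E4).

Then `π` is proper and birational, `X'` is integral, and EVERY stalk of `X'` satisfies the full clause
(`stub_fiModelOfCharts`). So the open core is: produce ONE such centre `J` on the integral Cohen–Macaulay `X₁`.

References: U. Görtz, T. Wedhorn, *Algebraic Geometry I*, Def. 13.90, Prop. 13.91, 13.96; The Stacks Project, Tags 0804,
02NS, 02OS, 02ND; R. Fedder, Trans. AMS 278 (1983), Thm. 3.4. [folklore]
-/

-- single-problem summit: the doubled namespace component is forced
set_option linter.dupNamespace false

noncomputable section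

namespace Summit.ResolutionOfSingularities.ResolutionOfSingularities.Theorems.FInjectiveMacaulayfication.FiModelOfCharts

open AlgebraicGeometry CategoryTheory Literature.AlgebraicGeometry.Resolution

/-- **THE ENGINE INTERFACE** (registered stub `stub_fiModelOfCharts`): a blow-up `π : X' → X₁` (universal property,
`IsBlowup π J`) of an integral locally Noetherian scheme along an ideal sheaf `J ≠ ⊥` such that (a) the stalks of `X₁` off
`supp J` satisfy the full clause and (b) on the affine opens of a cover, `Γ(U)` has characteristic `p`, `J(U) ≠ 0` is
generated by `x₁,…,x_r`, and the chart rings `Γ(U)[J(U)/xᵢ]` (`xᵢ ≠ 0`) satisfy the Cohen–Macaulay + Frobenius-closed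
clause at their maximal ideals containing `xᵢ/1`, is proper and birational with integral source all of whose stalks
satisfy the full clause. [folklore] -/
theorem stub_fiModelOfCharts : ∀ (p : ℕ) [Fact p.Prime] (X₁ X' : Scheme.{0}) [IsIntegral X₁] [IsLocallyNoetherian X₁]
    (J : X₁.IdealSheafData) (π : X' ⟶ X₁), J ≠ ⊥ → IsBlowup π J →
    (∀ x : X₁, x ∉ (J.support : Set X₁) →
      IsDomain (X₁.presheaf.stalk x) ∧ ∀ d : ℕ, ringKrullDim (X₁.presheaf.stalk x) = d →
        ∀ s : Fin d → X₁.presheaf.stalk x, (Ideal.span (Set.range s)).radical.IsMaximal →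
          RingTheory.Sequence.IsWeaklyRegular (X₁.presheaf.stalk x) (List.ofFn s) ∧
          ∀ y : X₁.presheaf.stalk x, (∃ e : ℕ, y ^ p ^ e ∈ Ideal.span
            ((fun z : X₁.presheaf.stalk x => z ^ p ^ e) ''
              (Ideal.span (Set.range s) : Set (X₁.presheaf.stalk x)))) → y ∈ Ideal.span (Set.range s)) →
    ∀ (S : Set X₁.affineOpens), (∀ x : X₁, ∃ U ∈ S, x ∈ (U : X₁.Opens)) →
    (∀ U ∈ S, CharP Γ(X₁, U) p ∧ J.ideal U ≠ ⊥ ∧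
      ∃ (r : ℕ) (x : Fin r → Γ(X₁, U)) (hxI : ∀ i, x i ∈ J.ideal U), Ideal.span (Set.range x) = J.ideal U ∧
        ∀ (i : Fin r), x i ≠ 0 →
          ∀ (Q : Ideal (HomogeneousLocalization.Away (reesGrading (J.ideal U)) (reesT (x i) (hxI i)))) [Q.IsMaximal],
          reesChartBase (x i) (hxI i) (x i) ∈ Q →
          ∀ d : ℕ, ringKrullDim (Localization.AtPrime Q) = d → ∀ s : Fin d → Localization.AtPrime Q,
            (Ideal.span (Set.range s)).radical.IsMaximal →
              RingTheory.Sequence.IsWeaklyRegular (Localization.AtPrime Q) (List.ofFn s) ∧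
              ∀ y : Localization.AtPrime Q, (∃ e : ℕ, y ^ p ^ e ∈ Ideal.span
                ((fun z : Localization.AtPrime Q => z ^ p ^ e) ''
                  (Ideal.span (Set.range s) : Set (Localization.AtPrime Q)))) → y ∈ Ideal.span (Set.range s)) →
    IsProper π ∧ Literature.AlgebraicGeometry.Resolution.IsBirational π ∧ IsIntegral X' ∧
      ∀ x : X', IsDomain (X'.presheaf.stalk x) ∧ ∀ d : ℕ, ringKrullDim (X'.presheaf.stalk x) = d →
        ∀ s : Fin d → X'.presheaf.stalk x, (Ideal.span (Set.range s)).radical.IsMaximal →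
          RingTheory.Sequence.IsWeaklyRegular (X'.presheaf.stalk x) (List.ofFn s) ∧
          ∀ z : X'.presheaf.stalk x, (∃ e : ℕ, z ^ p ^ e ∈
              Ideal.span ((fun w : X'.presheaf.stalk x => w ^ p ^ e) ''
                (Ideal.span (Set.range s) : Set (X'.presheaf.stalk x)))) →
            z ∈ Ideal.span (Set.range s) := by
  intro p _ X₁ X' _ _ J π hJ hπ hoff S hS hon
  refine FiModelOfIsBlowup.fiModel_of_isBlowup_of_isIntegral p hJ hπ S hS fun U hUS y => ?_
  obtain ⟨hchar, hI0, r, x, hxI, hspan, hcharts⟩ := hon U hUS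
  -- `Γ(X₁, U)` is a Noetherian domain of characteristic `p` (`U` is non-empty: `y` lies over a point of `U`)
  haveI : Nonempty (U : X₁.Opens) :=
    ⟨⟨_, ClauseOffCentre.fromSpec_mem U ((affineBlowup.π (J.ideal U)).base y)⟩⟩
  haveI : IsDomain Γ(X₁, U) := IsIntegral.component_integral (U : X₁.Opens)
  haveI : IsNoetherianRing Γ(X₁, U) := IsLocallyNoetherian.component_noetherian U
  haveI : CharP Γ(X₁, U) p := hchar
  -- (a) off the centre, ring level
  have hoff' := ClauseOffCentre.stub_clauseOffCentre p X₁ J U fun z _ hz => hoff z hz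
  -- E6″ on the stalks of `affineBlowup (J.ideal U)`
  exact AffineBlowupStalkClause.stub_affineBlowupStalkClause p Γ(X₁, U) (J.ideal U) r x hxI hspan hI0
    (fun P _ hP => hoff' P hP) hcharts y

end Summit.ResolutionOfSingularities.ResolutionOfSingularities.Theorems.FInjectiveMacaulayfication.FiModelOfCharts

end
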